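import Mathlib
import Summits.NavierStokesRegularity.NavierStokesRegularity.Theorems.FilamentSkeletonRssSkeletonEquilibriumLengthRegularOuter

/-!
# `stub_lengthRegular` holds for SLOW witnesses (stub-currency corollary)
(helper for the registered stub `stub_lengthRegular` of crux `FilamentSkeletonRss.SkeletonEquilibrium`,
stmt-NavierStokesRegularity-15400; SC-free conjunct `LengthRegular` of `ZeroAccretionSelection`)

`lengthRegular_of_slowWitness` is the registered statement of `stub_lengthRegular` VERBATIM (same binders,
same clauses, same conclusion `volume {τ | ‖Ξ k τ − x‖ ≤ D} ≤ ENNReal.ofReal (C₀ * D)` for `D ≥ √Γ`), with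
`0 < K` and exactly ONE extra hypothesis inserted after the relative-equilibrium clause: the skeleton's
regularised Biot–Savart velocity along every filament is SLOW, `8·K·‖u_skel(Ξ_j(τ))‖ ≤ √Γ`. Then
`C₀ = 4(3 + 4|α|) + 2/K` works (`LengthRegular.lengthRegular_of_slow`: radial monotonicity outside the
velocity ball + convexity of `‖Ξ‖²` inside it). Kernel-visible residue of the stub: remove the slowness
hypothesis, i.e. (i) an a-priori bound on the skeleton velocity along the filaments and (ii) no coiling
inside the velocity ball when it is larger than the curvature scale `√Γ/K`. The separation, injectivity and
integrability clauses are idle here.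

Also recorded (SC-free TAIL SIGN LAW, same abstract setting as `…LengthRegularRadial`): `abs_slip_ge`
(`|w| ≥ ½‖Ξ‖ − U` pointwise), `inner_pos_of_right_branch` / `slip_pos_of_right_branch` (beyond the inner
interval `{‖Ξ‖ ≤ 4U}` on the right, `⟪Ξ′, Ξ⟫ > 0` and `w > 0`) and `slip_neg_of_left_branch` (`w < 0` on the
left): every zero of the slip `w` of an equilibrium filament with induced velocity `≤ U` lies in the ONE
parameter interval where `‖Ξ‖ ≤ 4U` — the unique-zero clause of the crux is automatic outside the velocity
ball. No summit statement is proved; NS regularity is not touched.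
-/

noncomputable section

open Set Filter Topology MeasureTheory
open Literature.Analysis.FluidPDE Literature.Analysis.FluidPDE.Tao2016
open scoped RealInnerProductSpace InnerProductSpace

namespace Summit.NavierStokesRegularity.NavierStokesRegularity.Theorems.SkeletonEquilibrium.LengthRegular
set_option linter.dupNamespace false

/-- **`stub_lengthRegular` for slow witnesses.** The registered statement of `stub_lengthRegular` with
`0 < K` and the single extra hypothesis `∀ j τ, 8·K·‖u_skel(Ξ_j(τ))‖ ≤ √Γ` (slow skeleton velocity along the
filaments); constant `C₀ = 4(3 + 4|α|) + 2/K`. [folklore] -/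
theorem lengthRegular_of_slowWitness :
    ∀ (N : ℕ) (γ : Fin N → ℝ) (α ρ K : ℝ), α ≠ 0 → 0 < ρ → 0 < K →
      ∃ C₀ : ℝ, 0 < C₀ ∧ ∀ Γ : ℝ, 1 ≤ Γ →
        ∀ (Ξ : Fin N → ℝ → EuclideanSpace ℝ (Fin 3)) (w : Fin N → ℝ → ℝ),
          (∀ j, ContDiff ℝ 2 (Ξ j) ∧ Function.Injective (Ξ j) ∧ Differentiable ℝ (w j) ∧
              (∀ τ, ‖deriv (Ξ j) τ‖ = 1) ∧ (∀ τ, ‖iteratedDeriv 2 (Ξ j) τ‖ * Real.sqrt Γ ≤ K) ∧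
              Tendsto (fun τ => ‖Ξ j τ‖) atTop atTop ∧ Tendsto (fun τ => ‖Ξ j τ‖) atBot atTop) →
          (∀ j k, j ≠ k → ∀ τ σ, ρ * Real.sqrt Γ ≤ ‖Ξ j τ - Ξ k σ‖) →
          (∀ j (x : EuclideanSpace ℝ (Fin 3)), Integrable (fun σ : ℝ =>
              ((‖x - Ξ j σ‖ ^ 2 + 1) ^ (3 / 2 : ℝ))⁻¹ • cross (deriv (Ξ j) σ) (x - Ξ j σ))) →
          (∀ j τ, (∑ k : Fin N, (Γ * γ k / (4 * Real.pi)) • ∫ σ : ℝ,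
                ((‖Ξ j τ - Ξ k σ‖ ^ 2 + 1) ^ (3 / 2 : ℝ))⁻¹ • cross (deriv (Ξ k) σ) (Ξ j τ - Ξ k σ))
              + (1 / 2 : ℝ) • Ξ j τ - α • cross (EuclideanSpace.single (2 : Fin 3) (1 : ℝ)) (Ξ j τ)
              = w j τ • deriv (Ξ j) τ) →
          (∀ j τ, 8 * K * ‖∑ k : Fin N, (Γ * γ k / (4 * Real.pi)) • ∫ σ : ℝ,
                ((‖Ξ j τ - Ξ k σ‖ ^ 2 + 1) ^ (3 / 2 : ℝ))⁻¹ • cross (deriv (Ξ k) σ) (Ξ j τ - Ξ k σ)‖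
              ≤ Real.sqrt Γ) →
          ∀ (k : Fin N) (x : EuclideanSpace ℝ (Fin 3)) (D : ℝ), Real.sqrt Γ ≤ D →
            volume {τ : ℝ | ‖Ξ k τ - x‖ ≤ D} ≤ ENNReal.ofReal (C₀ * D) := by
  intro N γ α ρ K _ _ hK
  refine ⟨4 * (3 + 4 * |α|) + 2 / K, by positivity, ?_⟩
  intro Γ hΓ Ξ w hcl _ _ heq hslow i x D hD
  obtain ⟨hC2, -, -, hT, hκ, htop, hbot⟩ := hcl i
  have h8K : (0 : ℝ) < 8 * K := by positivity
  have hu : ∀ τ, ‖∑ k : Fin N, (Γ * γ k / (4 * Real.pi)) • ∫ σ : ℝ,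
      ((‖Ξ i τ - Ξ k σ‖ ^ 2 + 1) ^ (3 / 2 : ℝ))⁻¹ • cross (deriv (Ξ k) σ) (Ξ i τ - Ξ k σ)‖
        ≤ Real.sqrt Γ / (8 * K) := by
    intro τ
    rw [le_div_iff₀ h8K]
    have h := hslow i τ
    linarith
  have hslow' : 8 * (Real.sqrt Γ / (8 * K)) * K ≤ Real.sqrt Γ := by
    have : 8 * (Real.sqrt Γ / (8 * K)) * K = Real.sqrt Γ := by field_simp
    exact this.le
  exact lengthRegular_of_slow
    (u := fun τ => ∑ k : Fin N, (Γ * γ k / (4 * Real.pi)) • ∫ σ : ℝ,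
      ((‖Ξ i τ - Ξ k σ‖ ^ 2 + 1) ^ (3 / 2 : ℝ))⁻¹ • cross (deriv (Ξ k) σ) (Ξ i τ - Ξ k σ))
    hK hΓ hC2 hT hκ (fun τ => heq i τ) hu hslow' htop hbot x hD

/-! ## SC-free tail sign law for the slip -/

/-- **Supersonic slip, pointwise.** If `u + ½Ξ − α e₃×Ξ = w T` with `‖T‖ = 1` and `‖u‖ ≤ U` then
`½‖Ξ‖ − U ≤ |w|` (the drift has norm `≥ ½‖Ξ‖`, its rotation part being orthogonal to `Ξ`). [folklore] -/
theorem abs_slip_ge (α w U : ℝ) (u Ξ T : EuclideanSpace ℝ (Fin 3))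
    (h : u + (1 / 2 : ℝ) • Ξ - α • cross (EuclideanSpace.single (2 : Fin 3) (1 : ℝ)) Ξ = w • T)
    (hT : ‖T‖ = 1) (hu : ‖u‖ ≤ U) : 1 / 2 * ‖Ξ‖ - U ≤ |w| := by
  set B : EuclideanSpace ℝ (Fin 3) :=
    (1 / 2 : ℝ) • Ξ - α • cross (EuclideanSpace.single (2 : Fin 3) (1 : ℝ)) Ξ with hB
  have h1 : ⟪B, Ξ⟫ = 1 / 2 * ‖Ξ‖ ^ 2 := by
    rw [hB, inner_sub_left, real_inner_smul_left, real_inner_smul_left, inner_cross_self_right, mul_zero,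
      sub_zero, real_inner_self_eq_norm_sq]
  have h2 : ⟪B, Ξ⟫ ≤ ‖B‖ * ‖Ξ‖ := real_inner_le_norm B Ξ
  have h3 : 1 / 2 * ‖Ξ‖ ≤ ‖B‖ := by
    by_cases hy : ‖Ξ‖ = 0
    · rw [hy, mul_zero]; exact norm_nonneg _
    · have hy' : 0 < ‖Ξ‖ := lt_of_le_of_ne (norm_nonneg _) (Ne.symm hy)
      nlinarith
  have h4 : |w| = ‖w • T‖ := by rw [norm_smul, Real.norm_eq_abs, hT, mul_one]
  have h5 : w • T - B = u := by rw [← h, hB]; abel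
  have h6 : ‖B‖ - ‖w • T‖ ≤ ‖B - w • T‖ := norm_sub_norm_le _ _
  have h7 : ‖B - w • T‖ = ‖u‖ := by rw [← norm_neg, neg_sub, h5]
  rw [h7] at h6
  linarith

/-- **Radial transversality has the right sign on the right branch.** Beyond a point `s₀` of the velocity
ball (`s₀ ≤ τ`, `4U < ‖Ξ τ‖`), `⟪Ξ′(τ), Ξ(τ)⟫ > 0` (slopes of `‖Ξ‖` from the right are `≥ (3 + 4|α|)⁻¹` by
`right_branch_growth`). [folklore] -/
theorem inner_pos_of_right_branch {Ξ u : ℝ → EuclideanSpace ℝ (Fin 3)} {w : ℝ → ℝ} {α U : ℝ}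
    (hΞ : Differentiable ℝ Ξ) (hT : ∀ τ, ‖deriv Ξ τ‖ = 1)
    (heq : ∀ τ, u τ + (1 / 2 : ℝ) • Ξ τ - α • cross (EuclideanSpace.single (2 : Fin 3) (1 : ℝ)) (Ξ τ)
      = w τ • deriv Ξ τ)
    (hu : ∀ τ, ‖u τ‖ ≤ U) (htop : Tendsto (fun τ => ‖Ξ τ‖) atTop atTop)
    {s₀ : ℝ} (hs₀ : ‖Ξ s₀‖ ≤ 4 * U) {τ : ℝ} (hτ : s₀ ≤ τ ∧ 4 * U < ‖Ξ τ‖) :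
    0 < ⟪deriv Ξ τ, Ξ τ⟫ := by
  have hU0 : 0 ≤ U := le_trans (norm_nonneg _) (hu τ)
  have h0 : Ξ τ ≠ 0 := by
    intro h; have := hτ.2; rw [h, norm_zero] at this; linarith
  have hn : 0 < ‖Ξ τ‖ := norm_pos_iff.2 h0
  have hd := hasDerivAt_norm_curve hΞ h0
  have hc : (0 : ℝ) < (3 + 4 * |α|)⁻¹ := by positivity
  -- slopes from the right are bounded below by the growth rate
  have hev : ∀ᶠ τ' in nhdsWithin τ (Set.Ioi τ), (3 + 4 * |α|)⁻¹ ≤ slope (fun s => ‖Ξ s‖) τ τ' := by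
    filter_upwards [self_mem_nhdsWithin] with τ' hτ'
    have hτ'R : s₀ ≤ τ' ∧ 4 * U < ‖Ξ τ'‖ :=
      ⟨le_trans hτ.1 (le_of_lt hτ'), right_branch_up hΞ hT heq hu hs₀ hτ.1 hτ.2 (le_of_lt hτ')⟩
    have hg := right_branch_growth hΞ hT heq hu htop hs₀ hτ hτ'R (le_of_lt hτ')
    rw [slope_def_field, le_div_iff₀ (sub_pos.2 hτ')]
    exact hg
  have hlim : Tendsto (slope (fun s => ‖Ξ s‖) τ) (nhdsWithin τ (Set.Ioi τ))
      (nhds (⟪Ξ τ, deriv Ξ τ⟫ / ‖Ξ τ‖)) :=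
    hd.tendsto_slope.mono_left (nhdsWithin_mono _ fun x hx => ne_of_gt hx)
  have hge : (3 + 4 * |α|)⁻¹ ≤ ⟪Ξ τ, deriv Ξ τ⟫ / ‖Ξ τ‖ := ge_of_tendsto hlim hev
  have hpos : 0 < ⟪Ξ τ, deriv Ξ τ⟫ / ‖Ξ τ‖ := lt_of_lt_of_le hc hge
  rw [real_inner_comm]
  exact (div_pos_iff_of_pos_right hn).1 hpos

/-- **Tail sign law, right.** Beyond a point `s₀` of the velocity ball the slip is POSITIVE: `s₀ ≤ τ`,
`4U < ‖Ξ τ‖` ⇒ `0 < w τ` (pair the tangency relation with `Ξ`: `w⟪T,Ξ⟫ = ⟪u,Ξ⟫ + ½‖Ξ‖² > 0`, and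
`⟪T, Ξ⟫ > 0` by `inner_pos_of_right_branch`). No unique-zero clause is assumed. [folklore] -/
theorem slip_pos_of_right_branch {Ξ u : ℝ → EuclideanSpace ℝ (Fin 3)} {w : ℝ → ℝ} {α U : ℝ}
    (hΞ : Differentiable ℝ Ξ) (hT : ∀ τ, ‖deriv Ξ τ‖ = 1)
    (heq : ∀ τ, u τ + (1 / 2 : ℝ) • Ξ τ - α • cross (EuclideanSpace.single (2 : Fin 3) (1 : ℝ)) (Ξ τ)
      = w τ • deriv Ξ τ)
    (hu : ∀ τ, ‖u τ‖ ≤ U) (htop : Tendsto (fun τ => ‖Ξ τ‖) atTop atTop)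
    {s₀ : ℝ} (hs₀ : ‖Ξ s₀‖ ≤ 4 * U) {τ : ℝ} (hτ : s₀ ≤ τ ∧ 4 * U < ‖Ξ τ‖) : 0 < w τ := by
  have hip := inner_pos_of_right_branch hΞ hT heq hu htop hs₀ hτ
  have hid : w τ * ⟪deriv Ξ τ, Ξ τ⟫ = ⟪u τ, Ξ τ⟫ + 1 / 2 * ‖Ξ τ‖ ^ 2 := by
    have := congrArg (fun v => ⟪v, Ξ τ⟫) (heq τ)
    simp only [inner_add_left, inner_sub_left, real_inner_smul_left, inner_cross_self_right,
      mul_zero, sub_zero, real_inner_self_eq_norm_sq] at this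
    linarith
  have hcs : |⟪u τ, Ξ τ⟫| ≤ ‖u τ‖ * ‖Ξ τ‖ := abs_real_inner_le_norm _ _
  have hU0 : 0 ≤ U := le_trans (norm_nonneg _) (hu τ)
  have h1 : ‖u τ‖ * ‖Ξ τ‖ ≤ U * ‖Ξ τ‖ := mul_le_mul_of_nonneg_right (hu τ) (norm_nonneg _)
  have h2 : 0 < w τ * ⟪deriv Ξ τ, Ξ τ⟫ := by
    rw [hid]
    have := neg_abs_le ⟪u τ, Ξ τ⟫
    have h4 : 4 * U < ‖Ξ τ‖ := hτ.2
    nlinarith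
  exact (mul_pos_iff_of_pos_right hip).1 h2

/-- **Tail sign law, left.** Before a point `s₀` of the velocity ball the slip is NEGATIVE: `τ ≤ s₀`,
`4U < ‖Ξ τ‖` ⇒ `w τ < 0` (time reversal of `slip_pos_of_right_branch`). Hence every zero of `w` lies in
the inner interval `{‖Ξ‖ ≤ 4U}`. [folklore] -/
theorem slip_neg_of_left_branch {Ξ u : ℝ → EuclideanSpace ℝ (Fin 3)} {w : ℝ → ℝ} {α U : ℝ}
    (hΞ : Differentiable ℝ Ξ) (hT : ∀ τ, ‖deriv Ξ τ‖ = 1)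
    (heq : ∀ τ, u τ + (1 / 2 : ℝ) • Ξ τ - α • cross (EuclideanSpace.single (2 : Fin 3) (1 : ℝ)) (Ξ τ)
      = w τ • deriv Ξ τ)
    (hu : ∀ τ, ‖u τ‖ ≤ U) (hbot : Tendsto (fun τ => ‖Ξ τ‖) atBot atTop)
    {s₀ : ℝ} (hs₀ : ‖Ξ s₀‖ ≤ 4 * U) {τ : ℝ} (hτ : τ ≤ s₀ ∧ 4 * U < ‖Ξ τ‖) : w τ < 0 := by
  obtain ⟨hΞ', hT', heq'⟩ := reversal hΞ hT heq
  have hu' : ∀ s, ‖u (-s)‖ ≤ U := fun s => hu (-s)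
  have htop' : Tendsto (fun s => ‖Ξ (-s)‖) atTop atTop := hbot.comp tendsto_neg_atTop_atBot
  have hs₀' : ‖Ξ (-(-s₀))‖ ≤ 4 * U := by rw [neg_neg]; exact hs₀
  have h := slip_pos_of_right_branch (u := fun s => u (-s)) (w := fun s => -w (-s)) hΞ' hT' heq' hu'
    htop' hs₀' (τ := -τ) ⟨neg_le_neg hτ.1, by rw [neg_neg]; exact hτ.2⟩
  simp only [neg_neg] at h
  linarith

/-- **All zeros of the slip are in the velocity ball's interval.** If `w τ = 0` then `‖Ξ τ‖ ≤ 4U`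
(indeed `‖Ξ τ‖ ≤ 2U`): the waist-localisation inequality, recorded in the present vocabulary. [folklore] -/
theorem norm_le_of_slip_zero (α w U : ℝ) (u Ξ T : EuclideanSpace ℝ (Fin 3))
    (h : u + (1 / 2 : ℝ) • Ξ - α • cross (EuclideanSpace.single (2 : Fin 3) (1 : ℝ)) Ξ = w • T)
    (hT : ‖T‖ = 1) (hu : ‖u‖ ≤ U) (hw : w = 0) : ‖Ξ‖ ≤ 2 * U := by
  have := abs_slip_ge α w U u Ξ T h hT hu
  rw [hw, abs_zero] at this
  linarith

end Summit.NavierStokesRegularity.NavierStokesRegularity.Theorems.SkeletonEquilibrium.LengthRegular
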